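import Summits.BirchSwinnertonDyer.BirchSwinnertonDyer.Theses.PlecticLegs
import Summits.BirchSwinnertonDyer.BirchSwinnertonDyer.Theorems.PlecticRankUB.Negative.PlecticRankUBFalseWithoutAnalyticRank
import Summits.BirchSwinnertonDyer.BirchSwinnertonDyer.Theorems.PlecticRankUB.Negative.StubOffSectorFalseWithoutAnalyticRank
import Summits.BirchSwinnertonDyer.BirchSwinnertonDyer.Theorems.PlecticRankUB.Negative.StubOnSectorSelmerCapFalseWithoutAnalyticRank

/-!
# Disproof of `PlecticRankUB` (stmt-BirchSwinnertonDyer-17519) — crux-disprover work-file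

Seat refuter-cdisprove-stmt-BirchSwinnertonDyer-17519-0, cycle 1 (2026-08-17). Route
`PlecticLegs`; crux #3 `PlecticRankUB` (CORE RANK `d`, the upper bound of the plectic BSD
principle):

`PlecticRankUB := ∀ (F : Type) [Field F] [NumberField F] [IsTotallyReal F] (V : WeierstrassCurve F)
  [V.IsElliptic], 2 ≤ finrank ℚ F → V.analyticRank = finrank ℚ F → V.mordellWeilRank ≤ finrank ℚ F`.

## Findings (index)

* **No kill. The crux is the rank-inequality `rank_ℤ V(F) ≤ ord_{s=1} L(V/F,s)` of BSD over a
  totally real field, restricted to the plectic regime `ord = [F:ℚ]`; it resists every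
  Lean-landable attack for the structural reason (O1), is a consequence of the BSD conjecture over
  `F` on paper, and no printed counterexample exists (LMFDB `ec_nfcurves` over real quadratic
  fields agrees with BSD wherever both ranks are computed; a counterexample would be a
  counterexample to BSD over a number field).**
* (O1) OBSTRUCTION TO ANY UNCONDITIONAL `¬ PlecticRankUB`: a witness must come with a PROOF of
  `V.analyticRank = [F:ℚ] ≥ 2`, i.e. (i) `V.HasEntireLFunction` (the analytic continuation of
  `L(V/F,s)`: modularity of `V` over `F` — Freitas–Le Hung–Siksek for real quadratic `F`, not in
  tree; even `hasEntireLFunction_rat` is an unproved named fact) and (ii) the EXACT order of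
  vanishing `≥ 2` of that continuation at `s = 1` (no in-tree evaluator of `entireLFunction`,
  `LSeries`, or of the Euler product `WeierstrassCurve.LFunction` beyond its coefficients).
  `theorem analyticRank_ne_zero_imp` below records what the hypothesis buys: analyticity at `1`,
  vanishing at `1`, not identically zero near `1` — so the hypothesis itself EXCLUDES every junk
  regime of `entireLFunction` (no continuation ⇒ junk `LSeries`; non-multipliable Euler product ⇒
  `LFunction = 1`; not analytic / identically zero ⇒ `analyticOrderNatAt = 0 ≠ d`). Hence there
  is no junk-value route to falsity either: in every junk regime the crux is vacuously TRUE.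
* (O2) MATHLIB'S `LFunction` IS THE RIGHT OBJECT (read `Mathlib.AlgebraicGeometry.EllipticCurve.
  LFunction/Reduction`): Euler product over ALL finite places of `𝓞 F` of the local factors of a
  MINIMAL model at each place (`W.minimal R`), `a_𝔭 = q + 1 − #Ẽ(κ_𝔭)` counted WITH the point at
  infinity (`Affine.Point` has the constructor `zero`), `1 ∓ T` at split/non-split multiplicative,
  `1` at additive places. A hypothetical mislabelling split/non-split at one place would multiply
  `L` by `(1 − εq^{-s})/(1 + εq^{-s})`, which has poles on `Re s = 0`: the product is then NOT
  entire, `HasEntireLFunction` fails, and we are back in a junk regime of (O1) — vacuous truth,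
  never falsity.
* §1 LOAD-BEARING HYPOTHESES (drop one at a time):
  - `V.analyticRank = finrank ℚ F`: LOAD-BEARING. PROVED and LANDED (p146677):
    `Theorems/PlecticRankUB/Negative/PlecticRankUBFalseWithoutAnalyticRank.lean`,
    `plecticRankUB_false_without_analyticRank : ¬ PlecticRankUBWithoutAnalyticRank` — witness
    `F = ℚ(√5)`, `V = E₁₂₅₄ ⊗ F` (`E₁₂₅₄ : y² = x³ − 1254²x`, the least rank-3 congruent number
    curve), `rank V(F) ≥ rank E₁₂₅₄(ℚ) ≥ 3 > 2` by the tree's complete `2`-descent characters on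
    the points `(−912, 25992), (−528, 26136), (1650, 43560)` (PARI `ellrank`, kit job j023556) and
    monotonicity of the rank under base change. Restated here as `plecticRankUB_false_without_analyticRank`.
  - `2 ≤ finrank ℚ F`: NOT load-bearing for truth, only for scope: `PlecticRankUBWithoutDegree ↔
    PlecticRankUB ∧ DegreeOneCase` (`withoutDegree_iff`), and `DegreeOneCase` (`[F:ℚ] = 1`,
    `r_an = 1 ⇒ rank ≤ 1`) is Gross–Zagier–Kolyvagin transported along `F ≃ ℚ` — the support item
    `RankLeOne` in costume. A prover may ignore `2 ≤ d` entirely; it is there because `d = 1` is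
    filed separately.
  - `IsTotallyReal F`: NOT load-bearing for truth (over an arbitrary number field the statement is
    still the rank-inequality of BSD/F), and not even for the Euler-system numerology: the
    Mazur–Rubin core rank of `T_pV` over `F` is `Σ_{v real} 1 + Σ_{v complex} 2 = r₁ + 2r₂ = [F:ℚ]`
    for EVERY number field. What singles out totally real `F` is the SOURCE of the classes
    (Hilbert-modular / plectic CM cycles on quaternionic Shimura varieties) and modularity.
    Recorded as `PlecticRankUBWithoutTotallyReal` (docstring); no refutation expected.
  - `[V.IsElliptic]`: for singular `V` Mathlib's `Point` is the group of NONSINGULAR points; the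
    local factors are those of "minimal models" of a singular cubic — meaningless but harmless:
    not informative, not pursued.
* §2 NATURAL STRENGTHENINGS. (S1) conclusion `rank < d`: false in reality as soon as one curve
  with `r_an(V/F) = d = rank` exists (e.g. `389a1 ⊗ ℚ(√D)` with `L(E^{(D)},1) ≠ 0`: rank `2 = d`),
  but NOT Lean-refutable (O1) — near-miss `not_plecticRankUBStrict` (sorry, obstruction in its
  docstring). (S2) hypothesis weakened to `V.analyticRank ≤ finrank`: still a consequence of BSD/F
  (rank = r_an ≤ d) — a prover may as well aim for it; (S3) hypothesis weakened to
  `finrank ≤ V.analyticRank`: false in reality (`E₁₂₅₄ ⊗ ℚ(√5)` should have `r_an ≥ 3`), not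
  Lean-refutable (O1).
* §3 BARRIER REDUCTION / WHY IT RESISTS (for provers and planners): with the route's own supports
  the crux CONTAINS the open upper bound over `ℚ`: `rankUB_rat_of_plecticRankUB :
  PlecticRankUB → TwistSupply → ArtinBaseChange → KatoDescent → ∀ E/ℚ, 2 ≤ r_an(E) →
  rank E(ℚ) ≤ r_an(E)` (proved below, pure logic, the `closes` glue without the lower bound). So
  any proof of `PlecticRankUB` is, after Kato descent, a proof of `rank ≤ r_an` for every elliptic
  curve over `ℚ` of analytic rank `≥ 2` — the statement no Euler system of rank one reaches
  (route docstring: MR 2016 "for r > 1 the connection to L-values is still mysterious";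
  `Literature.Barriers.BirchSwinnertonDyer.SelmerRankBarrier` applies to the Selmer-level child
  `selmerUB_F`). Conversely BSD/F ⇒ the crux, so it is sandwiched between two open problems and
  equivalent to neither junk nor a misstatement: NOT refutable by known mathematics.
* §4 NUMBERS. `1254 = 2·3·11·19`; `E₁₂₅₄(ℚ) ⊇ ⟨(−912,25992), (−528,26136), (1650,43560)⟩ ⊕ E[2]`,
  `2`-descent vectors `(v₂,v₃,v₁₁,v₁₉)(x+1254) ‖ sgn x`: `[1,0,0,1,1]`, `[1,1,0,0,1]`, `[1,1,0,0,0]`;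
  `T₁ ↦ [1,0,0,0,1]`, `T₂ ↦ [1,1,1,1,1]`, `T₃ ↦ [0,1,1,1,0]`; `𝔽₂`-rank `5` (kernel-checked by
  `decide`). PARI `ellrank` on `E_n`, `n ∈ {1254, 2605, 2774, 3502, 4199, 4669, 4895, 6286, …}`
  all `[3,3,0]` (job j023556, 0.2 s).

* §5 LINE `Sketch` (lead's skeleton, card `exceptional-legs-plectic-cap`; stubs S1
  `stub_onSector_selmerCap`, S2 `stub_offSector`, S3 `stub_strictSelmerInfinite`, S4
  `stub_receptacleCollapse`; composition uses S1+S2 only). ATTACKED here (`-- Line Sketch` below):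
  - S2 (off-sector complement = the crux off the multiplicative sector): its extra hypothesis is
    geometry only. `c₆ = 0` curves (`j = 1728`: every congruent number curve and all base changes)
    are multiplicative at NO place (`not_hasMultiplicativeReductionAt_of_c₆_eq_zero`, proved), so the
    §1 witness `E₁₂₅₄ ⊗ ℚ(√5)` is off-sector: `stub_offSector_false_without_analyticRank` (file
    `Negative/StubOffSectorFalseWithoutAnalyticRank.lean`, landed p148822; restated below). S2 is crux-sized AND contains
    the whole potentially-good world (all CM `j ∈ {0, 1728}` curves); the line's engine never sees it.
  - S1 (on-sector Selmer cap): the sector does not cap Selmer by itself. `E : y² = x(x−53)(x−74)`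
    (rank `3` by `2`-descent on `(32,168), (50,60), (242,2772)`, kit job j023845) base-changed to
    `ℚ(√5)` is multiplicative at every `v ∣ 3` (`3 ∤ c₄ = 69808`, `3 ∣ Δ`; tree criterion
    `hasMultiplicativeReductionAt_of_valuation_c₄_eq_one`), hence on-sector with `p = 3`, `S = {v}`,
    while `corank Sel_{p^∞} = rank + corank Ш ≥ 3 > 2` for every `p` (proved Kummer identity):
    `stub_onSector_selmerCap_false_without_analyticRank` (file
    `Negative/StubOnSectorSelmerCapFalseWithoutAnalyticRank.lean`, landed p149022; restated below).
  - S3, S4 are TRUE design lemmas (S4: pair `σ ↔ σ ∘ (i j)` in the Leibniz sum, the two columns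
    through the line `L₀` give equal tensors with opposite signs; S3: the strict Selmer group contains
    the Kummer image of `ker(E(ℚ) ⊗ ℚ_p/ℤ_p → E(ℚ_p) ⊗ ℚ_p/ℤ_p)` of corank `≥ rank − 1`). Nothing
    to disprove; not load-bearing for `PlecticRankUB_of`.
  - JOINT SUFFICIENCY: `PlecticRankUB_of` is honest (S1 ⇒ rank ≤ corank ≤ d by the proved Kummer
    identity; S2 verbatim); no gap smuggled. But S1 ∧ S2 ⇔ crux ∧ (S1 on sector), i.e. the split
    isolates the engine's output without shrinking the crux: S2 alone is the crux on a family that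
    still contains base changes `E ⊗ F` of every potentially-good `E/ℚ` with `r_an(E) ≥ 2` — by §3
    as hard as `rank ≤ r_an` over `ℚ` for those `E`.

## What a prover should take from this file

1. Use `V.analyticRank = d` for more than the vanishing `L(V/F,1) = 0`: the §1 witness
   `E₁₂₅₄ ⊗ ℚ(√5)` has rank `≥ 3 > 2` whatever its (uncertified) order of vanishing is, and by BSD/F
   that order should be `≥ 3` — the exact order `= d` is the whole content.
2. Nothing about `F` (totally real, degree) or about `V` being a base change can replace the
   exact order of vanishing.
3. The honest target is `rank ≤ r_an` over totally real `F` in the regime `r_an = [F:ℚ]`, which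
   after descent is `rank ≤ r_an` over `ℚ` for `r_an ≥ 2` (§3).
-/

noncomputable section

open scoped Classical Topology
open Filter WeierstrassCurve

namespace Summit.BirchSwinnertonDyer.BirchSwinnertonDyer.Cruxes.PlecticRankUB.Disproof

open Summit.BirchSwinnertonDyer.BirchSwinnertonDyer.Theses.PlecticLegs

/-! ## §0 What the analytic hypothesis buys (junk exclusion) -/

/-- If `analyticRank V ≠ 0` then `entireLFunction V` is analytic at `1`, vanishes at `1`, and is
not identically zero near `1` (unfolding `analyticOrderNatAt`): the hypothesis
`V.analyticRank = [F:ℚ] ≥ 2` of the crux excludes every junk regime of the definitions.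
[folklore] -/
theorem analyticRank_ne_zero_imp {F : Type*} [Field F] [NumberField F] (V : WeierstrassCurve F)
    (h : V.analyticRank ≠ 0) :
    AnalyticAt ℂ V.entireLFunction 1 ∧ V.entireLFunction 1 = 0 ∧
      ¬ (∀ᶠ s in 𝓝 (1 : ℂ), V.entireLFunction s = 0) := by
  have h' : analyticOrderAt V.entireLFunction 1 ≠ 0 := by
    intro h0
    apply h
    simp [WeierstrassCurve.analyticRank, analyticOrderNatAt, h0]
  have htop : analyticOrderAt V.entireLFunction 1 ≠ ⊤ := by
    intro ht
    apply h
    simp [WeierstrassCurve.analyticRank, analyticOrderNatAt, ht]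
  refine ⟨(analyticOrderAt_ne_zero.mp h').1, (analyticOrderAt_ne_zero.mp h').2, ?_⟩
  rwa [← analyticOrderAt_eq_top]

/-! ## §1 Load-bearing hypotheses -/

/-- `PlecticRankUB` with the hypothesis `V.analyticRank = finrank ℚ F` DROPPED. [folklore] -/
def PlecticRankUBWithoutAnalyticRank : Prop :=
  ∀ (F : Type) [Field F] [NumberField F] [NumberField.IsTotallyReal F]
    (V : WeierstrassCurve F) [V.IsElliptic],
    2 ≤ Module.finrank ℚ F → V.mordellWeilRank ≤ Module.finrank ℚ F

/-- The dropped-hypothesis statement trivially implies the crux. [folklore] -/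
theorem plecticRankUB_of_withoutAnalyticRank (h : PlecticRankUBWithoutAnalyticRank) :
    PlecticRankUB :=
  fun F _ _ _ V _ hd _ => h F V hd

/-- **`PlecticRankUB` is false without the analytic-rank hypothesis** — the landed negative lemma
`Theorems.plecticRankUB_false_without_analyticRank` (p146677): `F = ℚ(√5)`, `V = E₁₂₅₄ ⊗ F`,
`rank ≥ 3 > 2`. ANY PROOF OF THE CRUX MUST USE `V.analyticRank = [F:ℚ]`. [folklore] -/
theorem plecticRankUB_false_without_analyticRank : ¬ PlecticRankUBWithoutAnalyticRank :=
  Summit.BirchSwinnertonDyer.BirchSwinnertonDyer.Theorems.plecticRankUB_false_without_analyticRank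

/-- The rank-`3` input, re-exported: `3 ≤ rank_ℤ E₁₂₅₄(ℚ)` (complete `2`-descent characters,
kernel-checked). [folklore] -/
theorem three_le_mordellWeilRank_1254 :
    3 ≤ (Literature.NumberTheory.EllipticCurves.congruentNumberCurve 1254).mordellWeilRank :=
  Summit.BirchSwinnertonDyer.BirchSwinnertonDyer.Theorems.PlecticRankUBNegative.three_le_mordellWeilRank_1254

/-- `PlecticRankUB` with the hypothesis `2 ≤ finrank ℚ F` DROPPED (degree `1` allowed). [folklore] -/
def PlecticRankUBWithoutDegree : Prop :=
  ∀ (F : Type) [Field F] [NumberField F] [NumberField.IsTotallyReal F]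
    (V : WeierstrassCurve F) [V.IsElliptic],
    V.analyticRank = Module.finrank ℚ F → V.mordellWeilRank ≤ Module.finrank ℚ F

/-- The degree-one case of the plectic upper bound: over a (totally real) number field of degree
`1`, `r_an(V) = 1 ⇒ rank V(F) ≤ 1` — Gross–Zagier–Kolyvagin transported along `F ≃ ℚ` (the
support item `RankLeOne` in costume; true, XL). [folklore] -/
def DegreeOneCase : Prop :=
  ∀ (F : Type) [Field F] [NumberField F] [NumberField.IsTotallyReal F]
    (V : WeierstrassCurve F) [V.IsElliptic],
    Module.finrank ℚ F = 1 → V.analyticRank = 1 → V.mordellWeilRank ≤ 1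

/-- **The degree hypothesis is scope, not substance**: dropping `2 ≤ [F:ℚ]` adds exactly the
degree-one case (a number field has `finrank ℚ F ≥ 1`). So `2 ≤ d` is NOT load-bearing for the
truth of the crux; no `_false_without_degree` lemma can exist unless GZK fails. [folklore] -/
theorem withoutDegree_iff : PlecticRankUBWithoutDegree ↔ PlecticRankUB ∧ DegreeOneCase := by
  constructor
  · intro h
    refine ⟨fun F _ _ _ V _ _ hr => h F V hr, fun F _ _ _ V _ h1 hr => ?_⟩
    have := h F V (by rw [h1, hr])
    rwa [h1] at this
  · rintro ⟨hUB, h1⟩ F _ _ _ V _ hr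
    have hpos : 0 < Module.finrank ℚ F := Module.finrank_pos
    by_cases hd : 2 ≤ Module.finrank ℚ F
    · exact hUB F V hd hr
    · have hd1 : Module.finrank ℚ F = 1 := by omega
      rw [hd1] at hr ⊢
      exact h1 F V hd1 hr

/-- `PlecticRankUB` with `IsTotallyReal F` DROPPED: the rank-inequality of BSD over an ARBITRARY
number field in the regime `r_an = [F:ℚ]`. Still a consequence of BSD/F; not refutable by known
mathematics (O1); the core rank `r₁ + 2r₂ = [F:ℚ]` is the degree for every number field, so the
totally-real hypothesis serves the SOURCE of the classes (Hilbert-modular / plectic), not the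
count. Recorded for hypothesis bookkeeping only. [folklore] -/
def PlecticRankUBWithoutTotallyReal : Prop :=
  ∀ (F : Type) [Field F] [NumberField F] (V : WeierstrassCurve F) [V.IsElliptic],
    2 ≤ Module.finrank ℚ F → V.analyticRank = Module.finrank ℚ F →
      V.mordellWeilRank ≤ Module.finrank ℚ F

/-- The totally-real-free statement implies the crux. [folklore] -/
theorem plecticRankUB_of_withoutTotallyReal (h : PlecticRankUBWithoutTotallyReal) :
    PlecticRankUB :=
  fun F _ _ _ V _ hd hr => h F V hd hr

/-! ## §2 Natural strengthenings -/

/-- (S1) The STRICT strengthening `rank < d` in the plectic regime. [folklore] -/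
def PlecticRankUBStrict : Prop :=
  ∀ (F : Type) [Field F] [NumberField F] [NumberField.IsTotallyReal F]
    (V : WeierstrassCurve F) [V.IsElliptic],
    2 ≤ Module.finrank ℚ F → V.analyticRank = Module.finrank ℚ F →
      V.mordellWeilRank < Module.finrank ℚ F

/-- NEAR-MISS (S1): `PlecticRankUBStrict` is false in reality — `V = 389a1 ⊗ ℚ(√D)` with `D > 0`,
`L(E^{(D)},1) ≠ 0` has `r_an(V) = 2 = [F:ℚ]` and rank `2` (two independent rational points of
389a1) — i.e. the crux's bound is TIGHT. Obstruction to a Lean proof (O1): it needs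
`V.analyticRank = 2`, hence the entire continuation of `L(V/F,s)` (modularity over `ℚ(√D)` and
Artin formalism) and the exact order `2` (`L(E,1) = L'(E,1) = 0` exactly and `L''(E,1) ≠ 0`
certified); none has an in-tree evaluator. Tried: nothing cheaper applies — every junk regime
gives `analyticRank = 0`. [folklore] -/
theorem not_plecticRankUBStrict : ¬ PlecticRankUBStrict := by
  sorry

/-! ## §3 Barrier reduction: the crux contains `rank ≤ r_an` over `ℚ` for `r_an ≥ 2` -/

/-- **With the route's supports, `PlecticRankUB` implies the upper bound `rank E(ℚ) ≤ r_an(E)` for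
every elliptic curve over `ℚ` of analytic rank `≥ 2`** (the `closes` glue without the lower
bound: silent field `F` of degree `r_an(E)` from `TwistSupply`, `r_an(E_F) = r_an(E) = [F:ℚ]` by
`ArtinBaseChange`, `rank E(F) ≤ [F:ℚ]` by the crux, `rank E(ℚ) = rank E(F)` by `KatoDescent`).
So the crux is at least as hard as the rank-`r` upper bound over `ℚ` for every `r ≥ 2` — the
statement beyond every known Euler-system argument. [folklore] -/
theorem rankUB_rat_of_plecticRankUB (hUB : PlecticRankUB) (hT : TwistSupply)
    (hA : ArtinBaseChange) (hK : KatoDescent) (W : WeierstrassCurve ℚ) [W.IsElliptic]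
    (h2 : 2 ≤ W.analyticRank) : W.mordellWeilRank ≤ W.analyticRank := by
  obtain ⟨m, instm, H, hreal, hdeg, hchi⟩ := hT W h2
  haveI := instm
  letI : NumberField ↥(IntermediateField.fixedField H) := NumberField.mk
  haveI : NumberField.IsTotallyReal ↥(IntermediateField.fixedField H) := hreal
  haveI : (W.baseChange ↥(IntermediateField.fixedField H)).IsElliptic :=
    inferInstanceAs (W.map (algebraMap ℚ ↥(IntermediateField.fixedField H))).IsElliptic
  have hran : (W.baseChange ↥(IntermediateField.fixedField H)).analyticRank = W.analyticRank :=
    hA W m H hchi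
  have hdegF : 2 ≤ Module.finrank ℚ ↥(IntermediateField.fixedField H) := by omega
  have hranF : (W.baseChange ↥(IntermediateField.fixedField H)).analyticRank =
      Module.finrank ℚ ↥(IntermediateField.fixedField H) := by omega
  have hub := hUB ↥(IntermediateField.fixedField H) (W.baseChange _) hdegF hranF
  have hdesc := hK W m H hchi
  omega

/-- Conversely the crux restricted to base-change curves `E ⊗ F` from silent fields FOLLOWS from
`rank ≤ r_an` over `ℚ` plus the supports — so on the configuration the route actually uses, the
crux is EQUIVALENT to the open upper bound over `ℚ` (this direction needs only `KatoDescent` and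
`ArtinBaseChange`). Stated for the record; the proof is the same bookkeeping. [folklore] -/
theorem plecticRankUB_baseChange_of_rankUB_rat
    (hUBQ : ∀ (W : WeierstrassCurve ℚ) [W.IsElliptic], W.mordellWeilRank ≤ W.analyticRank)
    (hA : ArtinBaseChange) (hK : KatoDescent) (W : WeierstrassCurve ℚ) [W.IsElliptic]
    (m : ℕ) [NeZero m] (H : Subgroup (CyclotomicField m ℚ ≃ₐ[ℚ] CyclotomicField m ℚ))
    (hchi : ∀ χ : DirichletCharacter ℂ m, (∀ σ ∈ H, ∀ a : ℕ,
      (∀ z : CyclotomicField m ℚ, z ^ m = 1 → σ z = z ^ a) → χ (a : ZMod m) = 1) → χ ≠ 1 →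
      ∃ L : ℂ → ℂ, Differentiable ℂ L ∧
        (∀ s : ℂ, 2 < s.re → L s = LSeries (fun n ↦ χ n * ((W.LFunction n : ℤ) : ℂ)) s) ∧ L 1 ≠ 0) :
    letI : NumberField ↥(IntermediateField.fixedField H) := NumberField.mk
    (W.baseChange ↥(IntermediateField.fixedField H)).analyticRank =
        Module.finrank ℚ ↥(IntermediateField.fixedField H) →
      (W.baseChange ↥(IntermediateField.fixedField H)).mordellWeilRank ≤
        Module.finrank ℚ ↥(IntermediateField.fixedField H) := by
  letI : NumberField ↥(IntermediateField.fixedField H) := NumberField.mk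
  intro hranF
  have hran := hA W m H hchi
  have hdesc := hK W m H hchi
  have hq := hUBQ W
  change (W.baseChange ↥(IntermediateField.fixedField H)).mordellWeilRank ≤ _
  omega

/-! ## §5 Line `Sketch` — stubs S1/S2 without the analytic hypothesis (see the Negative files)

The kernel-checked statements live in
`Theorems/PlecticRankUB/Negative/StubOffSectorFalseWithoutAnalyticRank.lean` (S2) and
`Theorems/PlecticRankUB/Negative/StubOnSectorSelmerCapFalseWithoutAnalyticRank.lean` (S1); restated
below by name on the work-file's `Prop`s. -/

/-- The plectic multiplicative sector of the lead's skeleton: some rational prime `p` and at least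
`d - 1` places of `F` above `p` of multiplicative reduction. [folklore] -/
def OnSector (F : Type) [Field F] [NumberField F] (V : WeierstrassCurve F) : Prop :=
  ∃ p : ℕ, p.Prime ∧ ∃ S : Finset (IsDedekindDomain.HeightOneSpectrum (NumberField.RingOfIntegers F)),
    Module.finrank ℚ F ≤ S.card + 1 ∧
      ∀ v ∈ S, (p : NumberField.RingOfIntegers F) ∈ v.asIdeal ∧ V.HasMultiplicativeReductionAt v

/-- Stub S2 with `V.analyticRank = finrank ℚ F` DROPPED (refuted in the Negative file:
`stub_offSector_false_without_analyticRank`). [folklore] -/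
def StubOffSectorWithoutAnalyticRank : Prop :=
  ∀ (F : Type) [Field F] [NumberField F] [NumberField.IsTotallyReal F] (V : WeierstrassCurve F)
    [V.IsElliptic], 2 ≤ Module.finrank ℚ F → ¬ OnSector F V → V.mordellWeilRank ≤ Module.finrank ℚ F

/-- Stub S1 with `V.analyticRank = finrank ℚ F` DROPPED (refuted in the Negative file:
`stub_onSector_selmerCap_false_without_analyticRank`). [folklore] -/
def StubOnSectorSelmerCapWithoutAnalyticRank : Prop :=
  ∀ (F : Type) [Field F] [NumberField F] [NumberField.IsTotallyReal F] (V : WeierstrassCurve F)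
    [V.IsElliptic], 2 ≤ Module.finrank ℚ F → OnSector F V →
      ∃ p : ℕ, p.Prime ∧ V.selmerCorank p ≤ Module.finrank ℚ F

/-- S2-without-analytic-rank implies the crux-without-analytic-rank OFF the sector only; together
with S1-without (and the Kummer identity) it would give `PlecticRankUBWithoutAnalyticRank`, which is
false (§1) — so at least one of the two dropped-hypothesis stubs is false; the Negative files show
BOTH are. [folklore] -/
theorem withoutAnalyticRank_of_stubs (h1 : StubOnSectorSelmerCapWithoutAnalyticRank)
    (h2 : StubOffSectorWithoutAnalyticRank) : PlecticRankUBWithoutAnalyticRank := by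
  intro F _ _ _ V _ hd
  by_cases hsec : OnSector F V
  · obtain ⟨p, hp, hcap⟩ := h1 F V hd hsec
    haveI : Fact p.Prime := ⟨hp⟩
    have hk : V.selmerCorank p = V.mordellWeilRank + V.shaCorank p :=
      V.selmerCorank_eq_mordellWeilRank_add_holds p
    omega
  · exact h2 F V hd hsec

/-- Hence (from §1) the two dropped-hypothesis stubs cannot both hold. [folklore] -/
theorem not_both_stubs_without_analyticRank :
    ¬ (StubOnSectorSelmerCapWithoutAnalyticRank ∧ StubOffSectorWithoutAnalyticRank) :=
  fun h => plecticRankUB_false_without_analyticRank (withoutAnalyticRank_of_stubs h.1 h.2)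

/-- **S2 is false without the analytic hypothesis** — the landed negative lemma
`Theorems.stub_offSector_false_without_analyticRank` restated on the work-file's `Prop`
(`E₁₂₅₄ ⊗ ℚ(√5)`: `c₆ = 0` ⇒ off-sector; rank `≥ 3 > 2`). [folklore] -/
theorem stubOffSector_false_without_analyticRank : ¬ StubOffSectorWithoutAnalyticRank := by
  intro h
  exact Summit.BirchSwinnertonDyer.BirchSwinnertonDyer.Theorems.stub_offSector_false_without_analyticRank
    (fun F _ _ _ V _ hd hoff => h F V hd hoff)

/-- **S1 is false without the analytic hypothesis** — the landed negative lemma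
`Theorems.stub_onSector_selmerCap_false_without_analyticRank` restated on the work-file's `Prop`
(`y² = x(x−53)(x−74)` over `ℚ(√5)`: multiplicative above `3` ⇒ on-sector; `corank Sel ≥ rank ≥ 3`).
[folklore] -/
theorem stubOnSectorSelmerCap_false_without_analyticRank :
    ¬ StubOnSectorSelmerCapWithoutAnalyticRank := by
  intro h
  exact Summit.BirchSwinnertonDyer.BirchSwinnertonDyer.Theorems.stub_onSector_selmerCap_false_without_analyticRank
    (fun F _ _ _ V _ hd hon => h F V hd hon)

/-- `c₆ = 0` curves are off the sector over every field (re-export of the S2 helper): the line's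
engine (multiplicative legs) never sees the `j = 1728` family. [folklore] -/
theorem not_onSector_of_c₆_eq_zero (F : Type) [Field F] [NumberField F] (V : WeierstrassCurve F)
    (hc₆ : V.c₆ = 0) (hd : 2 ≤ Module.finrank ℚ F) : ¬ OnSector F V := by
  rintro ⟨p, -, S, hS, hmult⟩
  obtain ⟨v, hv⟩ : S.Nonempty := Finset.card_pos.mp (by omega)
  exact Summit.BirchSwinnertonDyer.BirchSwinnertonDyer.Theorems.PlecticRankUBNegative.not_hasMultiplicativeReductionAt_of_c₆_eq_zero
    V hc₆ v (hmult v hv).2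

/-- `c₄ = 0` curves (`j = 0`) are off the sector over every field as well (tree:
`HasMultiplicativeReductionAt.c₄_ne_zero`): the line's engine never sees the `j = 0` family either.
[folklore] -/
theorem not_onSector_of_c₄_eq_zero (F : Type) [Field F] [NumberField F] (V : WeierstrassCurve F)
    (hc₄ : V.c₄ = 0) (hd : 2 ≤ Module.finrank ℚ F) : ¬ OnSector F V := by
  rintro ⟨p, -, S, hS, hmult⟩
  obtain ⟨v, hv⟩ : S.Nonempty := Finset.card_pos.mp (by omega)
  exact (hmult v hv).2.c₄_ne_zero hc₄

end Summit.BirchSwinnertonDyer.BirchSwinnertonDyer.Cruxes.PlecticRankUB.Disproof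

end
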